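import Literature.Probability.LatticeModels.ObservableContinuumBounds
import HarnessLib

/-!
# From a lattice bulk sup bound to `|F_δ| ≤ M √δ` on compacts, for an abstract family

Topic `Literature/Probability/LatticeModels`; the observable-independent form of
`IsDiscretisation.exists_sqrt_bound` (`ObservableContinuumBounds.lean`, Smirnov 2010 §5 for the
FK observable), so that it serves the spin fermion of Chelkak–Hongler–Izyurov 2015 (Thm 3.12:
"the functions `ϑ(δ)^{-1} F_δ` are uniformly bounded on compact subsets", with `ϑ(δ) ≍ √δ` in the
tree's normalisation) whose lattice sup bound is `KCObservableBulkBounds.norm_kcObs_le_of_bulk` /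
`KCObservableGaugedBounds.norm_kcObs_le_of_gaugedBulk`.

* `LatticeSupHyp F K ρ C`: at every mesh `δ` of a set eventually containing `𝓝[>] 0`, for every
  site `x` with mesh point in `K` and every scale `p ≥ 8` with `δ (32 p + 3) ≤ ρ`, the family is
  bounded by `C/√p` on the horizontal and vertical edges at the sites of the ball of radius `p`
  about `x` — the shape delivered by the lattice theory on bulk balls;
* **`exists_sqrt_bound_of_latticeSupHyp`**: then `‖F_δ(e)‖ ≤ M √δ` at the edges at sites with mesh
  point in `K`, eventually, with `M = C √(128/ρ)`.

Everything is proved; no named fact.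

## References

* S. Smirnov, Ann. of Math. 172 (2010), §5 [Smirnov2010].
* D. Chelkak, C. Hongler, K. Izyurov, Ann. of Math. 181 (2015), Thm 3.12 [ChelkakHonglerIzyurovAnnals2015].
-/

noncomputable section

namespace Literature.Probability.LatticeModels

open Filter _root_.Topology Metric Set Finset

/-- **The lattice sup hypothesis** for a family of bond functions `F δ` on a set `K`: bulk sup bounds
`C/√p` on every ball of lattice radius `p` about a site with mesh point in `K`, as long as the ball
of radius `32p + 3` has Euclidean size `≤ ρ`. [cite: Smirnov2010, §5] -/
def LatticeSupHyp (F : ℝ → MedialVertex → ℂ) (K : Set ℂ) (ρ C : ℝ) : Prop :=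
  ∀ᶠ δ in 𝓝[>] (0 : ℝ), ∀ x : Site 2, meshPoint δ x ∈ K → ∀ p : ℕ, 8 ≤ p →
    δ * (2 * (2 * (2 * (4 * (p : ℝ)))) + 3) ≤ ρ →
      ∀ y ∈ latticeBall x p, ∀ i : Fin 4, (i = 0 ∨ i = 1) → ‖F δ (cSrc (y, i))‖ ≤ C / Real.sqrt p

/-- **`|F_δ| ≤ M √δ` on `K` from the lattice sup hypothesis.** [cite: Smirnov2010, §5; ChelkakHonglerIzyurovAnnals2015, Thm 3.12 (3.12)] -/
theorem exists_sqrt_bound_of_latticeSupHyp {F : ℝ → MedialVertex → ℂ} {K : Set ℂ} {ρ C : ℝ} (hρ : 0 < ρ) (hC : 0 ≤ C)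
    (h : LatticeSupHyp F K ρ C) :
    ∃ M : ℝ, 0 ≤ M ∧ ∀ᶠ δ in 𝓝[>] (0 : ℝ), ∀ x : Site 2, meshPoint δ x ∈ K → ∀ i : Fin 4, (i = 0 ∨ i = 1) →
      ‖F δ (cSrc (x, i))‖ ≤ M * Real.sqrt δ := by
  refine ⟨C * Real.sqrt (128 / ρ), by positivity, ?_⟩
  have hc : (0 : ℝ) < ρ / 1000 := by positivity
  have h2 : ∀ᶠ δ in 𝓝[>] (0 : ℝ), δ < ρ / 1000 := nhdsWithin_le_nhds (Iio_mem_nhds hc)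
  have h3 : ∀ᶠ δ in 𝓝[>] (0 : ℝ), 0 < δ := self_mem_nhdsWithin
  filter_upwards [h, h2, h3] with δ H hδs hδ0 x hx i hi
  -- the lattice scale `p ≈ ρ/(64 δ)`
  set p : ℕ := ⌊ρ / (64 * δ)⌋₊ with hpdef
  have hpr : (0 : ℝ) < ρ / (64 * δ) := by positivity
  have hple : (p : ℝ) ≤ ρ / (64 * δ) := Nat.floor_le hpr.le
  have hplt : ρ / (64 * δ) < p + 1 := Nat.lt_floor_add_one _
  have hbig : (15 : ℝ) ≤ ρ / (64 * δ) := by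
    rw [le_div_iff₀ (by positivity)]; linarith
  have hp8 : 8 ≤ p := by
    have : (8 : ℝ) ≤ p := by linarith
    exact_mod_cast this
  have hpge : ρ / (128 * δ) ≤ p := by
    have : ρ / (128 * δ) = ρ / (64 * δ) / 2 := by field_simp; ring
    rw [this]; linarith
  have hsize : δ * (2 * (2 * (2 * (4 * (p : ℝ)))) + 3) ≤ ρ := by
    have h1 : δ * p ≤ ρ / 64 := by
      rw [le_div_iff₀ (by norm_num : (0:ℝ) < 64)]
      have := mul_le_mul_of_nonneg_left hple (by positivity : (0 : ℝ) ≤ 64 * δ)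
      rw [mul_div_cancel₀ _ (by positivity)] at this
      linarith
    nlinarith
  have hxball : x ∈ latticeBall x p := by
    rw [mem_latticeBall]; intro j; constructor <;> linarith [show (0 : ℤ) ≤ p from by positivity]
  have key := H x hx p hp8 hsize x hxball i hi
  have hsp : 0 < Real.sqrt p := Real.sqrt_pos.2 (by exact_mod_cast (show 0 < p by omega))
  calc ‖F δ (cSrc (x, i))‖ ≤ C / Real.sqrt p := key
    _ ≤ C / Real.sqrt (ρ / (128 * δ)) := by gcongr
    _ = C * Real.sqrt (128 / ρ) * Real.sqrt δ := by
        rw [mul_assoc, ← Real.sqrt_mul (by positivity), div_eq_mul_inv, ← Real.sqrt_inv]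
        congr 2; field_simp

end Literature.Probability.LatticeModels
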